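import Literature.AnabelianGeometry.EtaleTheta.SettingModelTateTheta
import Literature.AnabelianGeometry.EtaleTheta.SettingModelTateDeltaTheta
import Literature.AnabelianGeometry.EtaleTheta.SettingModelTateDoubleUnderline
import Literature.AnabelianGeometry.EtaleTheta.SettingModelChiCyclotomes
import Literature.AnabelianGeometry.EtaleTheta.Discharge.Sec1Prop15iiOfCoreSection
import HarnessLib

/-!
# The STAGE-2 (Tate-sheared) χ-model of [EtTh] §1: the `z`-coordinate lift of `log(Θ)` and clause (a) of
# Prop. 1.5 (i)/(ii) at `ThetaSetting.modelχq p i j hj`, for ANY Kummer core and ANY Galois section there (proof-only)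

Mochizuki, *The étale theta function …*, Publ. RIMS **45** (2009) [EtTh], §1, Prop. 1.5, PRIMS PDF p. 23
[cite: MochizukiEtTh2009, Prop 1.5 p.23]: "`F⁰/F¹ = Hom(Δ_Θ, Δ_Θ) = Ẑ·log(Θ)`", "`F̈⁰/F̈¹ = Hom(Δ_Θ, Δ_Θ)`", and
Prop. 1.5 (iii) "a unique class … that maps to `log(Θ)`".

PROOF-ONLY file (abc-iut cell, layer L2, R78 cluster STAGE 2; seat abc-iut-L6-d5 gen 4, follow-on of the R184 row
«Prop 1.5 (ii) FACT → THEOREM»; no definition, no instance, no `Prop` fact). The stage-2 twin of this seat's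
`SettingModelChiProp15ii.lean` (stage 1), over abc-iut-L2-t5/L2-t6's sheared carrier `PiTpχq p i j = Γ ⋊_{(κ_p^i, κ_p^j, χ)}
G_{ℚ_p}` and record `ThetaSetting.modelχq p i j hj` (`SettingModelTateSemidirect` / `SettingModelTateTheta`; instance keys of `SettingModelTateDoubleUnderline`), abc-iut-L6-d6's
centre coordinate `cThetaχq` / `deltaThetaCoordχq` (`SettingModelTateDeltaTheta`) and the root theorems of
`Discharge/Sec1Prop15iiOfCoreSection.lean` — all BY NAME.
The Tate shear is INVISIBLE on the two places the argument lives: on degree-`0` elements the action is the diagonal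
χ-twist at every level (`hHat_gfpFst_actχq_of_gfpSnd_eq_one`), and the theta kernel is level-trivial. Hence:

* **`exists_res_eq_logTheta_gtpY_modelχq`** / `…gtpYdd…` — ONE lift of `log(Θ)` to `H¹((Π^tp_Y)^Θ, Δ_Θ)` (resp.
  `(Π^tp_Ÿ)^Θ`): the class of the `z`-COORDINATE crossed homomorphism `h ↦ c^{ẑ(h)}` (levels `ĥ_N(·).z`; continuous;
  additive on `Ker ê` by the Heisenberg law; χ-twisting on degree `0`; descending to `(Π^tp_X)^Θ`; identity on `c^t`);
* **`res_deltaTheta_surjective_gtpY_modelχq`** / `…gtpYdd…` — clause (a) «`F⁰/F¹ = Hom(Δ_Θ, Δ_Θ)`» HOLDS at stage 2 on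
  `Y` and `Ÿ`, for any Kummer core `C` of `modelχq` (the power-limit binder is discharged from `C`:
  `KummerCore.res_deltaTheta_surjective_of_res_eq_logTheta`);
* **`prop15ii_ofSection_modelχq`** / **`prop15i_ofSection_modelχq`** — for ANY Kummer core `C` of `modelχq` and ANY
  continuous Galois section `s` (`aug ∘ s = id`, `s(G_K) ≤ Π^tp_Y`, `s(G_K̈) ≤ Π^tp_Ÿ`), the typed Prop. 1.5 (ii) (resp. (i))
  for `C.toKummerDataOfSection s …` reduces to the ONE datum clause `C.logUdd ∈ F̈¹` (resp. `C.logU ∈ F¹`) — the F6q/F7q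
  instances (w5-d171's `YCoordKit` classes, whose `y`-coordinate dies on `Δ_Θ = c^Ẑ`; L2-t6's section datum) plug in
  by name.

HONEST FRAMING: SEMI-SYNTHETIC model (the Tate-sheared χ-twisted root); consistency / non-vacuity evidence for the typed
interface ONLY; nothing of [EtTh] is asserted; typed ≠ proved; no side is taken on [IUTchIII] Cor. 3.12.
-/

noncomputable section

open CategoryTheory ProfiniteGrp ProfiniteGrp.ProfiniteCompletion

namespace Literature.AnabelianGeometry.EtaleTheta.SettingModel

open Literature.AnabelianGeometry.SemiGraphs _root_.Topology _root_.Function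
open scoped IsMulCommutative commutatorElement

variable (p : ℕ) [Fact p.Prime] (i j : ℤ)

/-! ### Clause (a): the `z`-coordinate lift of `log(Θ)` at stage 2 -/

/-- On the theta kernel of `curveχq` the degree is `0`: `pr₂ k.left = 1`. [cite: MochizukiEtTh2009, §1 p.12] -/
theorem gfpSnd_left_eq_one_of_mem_thetaKerχq {k : PiTpχq p i j} (hk : k ∈ CurveTheta.thetaKer (curveχq p i j)) :
    gfpSnd k.left = 1 := by
  have h1 : eHat (gfpFst k.left) = 1 := by
    refine ext_of_modN fun N => ?_
    rw [map_one, ← hHat_x_eq_modN_eHat, ((mem_thetaKerχq_iff p i j k).mp hk).1 N]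
    rfl
  rw [gfpFst_apply, (mem_Gfp _).mp k.left.2] at h1
  exact iotaZ_injective (h1.trans (map_one iotaZ).symm)

/-- **A lift of `log(Θ)` to `H¹((Π^tp_Y)^Θ, Δ_Θ)` at the stage-2 model `modelχq`**: the class of the `z`-coordinate
crossed homomorphism `h ↦ c^{ẑ(h)}` restricts to the identity `log(Θ)` on `Δ_Θ = c^Ẑ` (the Tate shear is invisible
on degree `0` and on the theta kernel). [cite: MochizukiEtTh2009, Prop 1.5 (iii) p.23] -/
theorem exists_res_eq_logTheta_gtpY_modelχq (hj : Even j)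
    (hle : (ThetaSetting.modelχq p i j hj).DeltaTheta ≤
      (ThetaSetting.modelχq p i j hj).GtpY.map (ThetaSetting.modelχq p i j hj).toTheta) :
    ∃ x : (ThetaSetting.modelχq p i j hj).H1Theta
        ((ThetaSetting.modelχq p i j hj).GtpY.map (ThetaSetting.modelχq p i j hj).toTheta),
      ContH1.res (MonoidHom.id (ThetaSetting.modelχq p i j hj).GtpTheta) (ThetaSetting.modelχq p i j hj).DeltaTheta
        hle x = (ThetaSetting.modelχq p i j hj).logTheta := by
  -- (1) the `Ẑ`-valued `z`-coordinate on `F̂₂`, levelwise `ĥ_N(·).z`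
  choose zC hzC using fun w : F₂hatT => exists_zHat_forall_hHat_z_eq w
  have hzext : ∀ {w : F₂hatT} {t : ZH},
      (∀ N : ℕ+, (hHat N w).z = Multiplicative.toAdd (modN N t)) → zC w = t :=
    fun h => ext_of_modN fun N => Multiplicative.toAdd.injective (by rw [hzC, h N])
  have hcont : Continuous zC := by
    refine ZHatLevel.continuous_of_isLocallyConstant_level zC fun N => ?_
    have heq : (fun w : F₂hatT => ZHatLevel.level N (zC w)) = fun w => Multiplicative.ofAdd (hHat N w).z := by
      funext w
      rw [← modN_eq_level, ← hzC w N, ofAdd_toAdd]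
    rw [heq]
    exact ((IsLocallyConstant.iff_continuous _).2 (hHat N).continuous).comp fun h => Multiplicative.ofAdd h.z
  have hmul : ∀ w w' : F₂hatT, eHat w = 1 → zC (w * w') = zC w * zC w' := by
    intro w w' hw
    refine hzext fun N => ?_
    rw [map_mul (modN N), toAdd_mul, hzC w N, hzC w' N, map_mul (hHat N)]
    show (hHat N w).z + (hHat N w').z + (hHat N w).x * (hHat N w').y = _
    rw [hHat_x_eq_zero_of_eHat_eq_one N hw, zero_mul, add_zero]
  have hker : ∀ w w' : F₂hatT, (∀ N : ℕ+, hHat N w' = 1) → zC (w * w') = zC w := fun w w' h =>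
    hzext fun N => by rw [map_mul (hHat N), h N, mul_one, hzC]
  -- the sheared action on DEGREE-0 elements acts on `z` through `χ`
  have htw : ∀ (σ : GQp p) (γ : Gfp), gfpSnd γ = 1 →
      zC (gfpFst (actχq p i j σ γ)) = chi p σ (zC (gfpFst γ)) := by
    intro σ γ hγ
    refine hzext fun N => ?_
    rw [hHat_gfpFst_actχq_of_gfpSnd_eq_one p i j N σ hγ, Heis.diagTwist_apply, modN_eq_level,
      ZHatLevel.toAdd_level_aut, ← modN_eq_level, hzC]
  have hc : ∀ t : ZH, zC (powHat (eta ⁅FreeGroup.of (0 : Fin 2), FreeGroup.of 1⁆) t) = t := fun t =>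
    hzext fun N => by rw [hHat_powHat_commutator, modN_eq_level]
  -- (2) descent to `(Π^tp_X)^Θ`: the theta kernel is level-trivial of degree `0` with trivial Galois component
  obtain ⟨zT, hzT, hzTc⟩ : ∃ zT : CurveTheta.GTheta (curveχq p i j) → ZH,
      (∀ g : PiTpχq p i j, zT (CurveTheta.toTheta (curveχq p i j) g) = zC (gfpFst g.left)) ∧ Continuous zT := by
    refine ⟨Quotient.lift (fun g : PiTpχq p i j => zC (gfpFst g.left)) ?_, fun g => rfl, ?_⟩
    · intro a b hab
      have hab' : a⁻¹ * b ∈ CurveTheta.thetaKer (curveχq p i j) := QuotientGroup.leftRel_apply.mp hab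
      show zC (gfpFst a.left) = zC (gfpFst b.left)
      conv_rhs => rw [← mul_inv_cancel_left a b]
      rw [SemidirectProduct.mul_left, map_mul]
      exact (hker _ _ fun N => by
        rw [hHat_gfpFst_actχq_of_gfpSnd_eq_one p i j N _ (gfpSnd_left_eq_one_of_mem_thetaKerχq p i j hab'),
          ((mem_thetaKerχq_iff p i j _).mp hab').1 N, map_one]).symm
    · exact (QuotientGroup.isQuotientMap_mk (CurveTheta.thetaKer (curveχq p i j))).continuous_iff.mpr
        (hcont.comp (gfpFst.continuous.comp (Semidirect.continuous_left (isInducing_leftRightχq p i j))))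
  -- on `Π^tp_Y = Ker(Π^tp_X ↠ Z)` the degree vanishes
  have hdeg : ∀ g : PiTpχq p i j, g ∈ (ThetaSetting.modelχq p i j hj).GtpY → gfpSnd g.left = 1 := fun g hg => hg
  have heY : ∀ g : PiTpχq p i j, g ∈ (ThetaSetting.modelχq p i j hj).GtpY → eHat (gfpFst g.left) = 1 := by
    intro g hg
    rw [gfpFst_apply, (mem_Gfp _).mp g.left.2]
    change iotaZ (gfpSnd g.left) = 1
    rw [hdeg g hg, map_one]
  -- the crossed law `ẑ(xy) = ẑ(x) · χ(aug^Θ x)(ẑ(y))` on `(Π^tp_Y)^Θ`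
  have hlaw : ∀ x y : ↥((ThetaSetting.modelχq p i j hj).GtpY.map (ThetaSetting.modelχq p i j hj).toTheta),
      zT ((x : CurveTheta.GTheta (curveχq p i j)) * y) =
        zT x * chi p (CurveTheta.augTheta (curveχq p i j) x) (zT y) := by
    rintro ⟨_, g, hg, rfl⟩ ⟨_, h, hh, rfl⟩
    show zT (CurveTheta.toTheta (curveχq p i j) g * CurveTheta.toTheta (curveχq p i j) h) =
      zT (CurveTheta.toTheta (curveχq p i j) g) *
        chi p (CurveTheta.augTheta (curveχq p i j) (CurveTheta.toTheta (curveχq p i j) g))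
          (zT (CurveTheta.toTheta (curveχq p i j) h))
    rw [← map_mul, hzT, hzT, hzT, CurveTheta.augTheta_toTheta, SemidirectProduct.mul_left, map_mul,
      hmul _ _ (heY g hg), htw _ _ (hdeg h hh)]
    rfl
  -- (3) the cocycle `h ↦ c^{ẑ(h)}` on `(Π^tp_Y)^Θ`
  let f : ↥((ThetaSetting.modelχq p i j hj).GtpY.map (ThetaSetting.modelχq p i j hj).toTheta) →
      ↥(ThetaSetting.modelχq p i j hj).DeltaTheta := fun h => deltaThetaCoordχq p i j (zT h)
  have hf : f ∈ contCocycles (MonoidHom.id (ThetaSetting.modelχq p i j hj).GtpTheta) (ThetaSetting.modelχq p i j hj).DeltaTheta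
      ((ThetaSetting.modelχq p i j hj).GtpY.map (ThetaSetting.modelχq p i j hj).toTheta) := by
    refine ⟨(continuous_deltaThetaCoordχq p i j).comp (hzTc.comp continuous_subtype_val), fun x y => ?_⟩
    show deltaThetaCoordχq p i j (zT ((x : CurveTheta.GTheta (curveχq p i j)) * y)) =
      deltaThetaCoordχq p i j (zT x) *
        MulAut.conjNormal ((MonoidHom.id _) (x : CurveTheta.GTheta (curveχq p i j))) (deltaThetaCoordχq p i j (zT y))
    rw [hlaw, map_mul, MonoidHom.id_apply, ← deltaThetaCoordχq_chi]
  refine ⟨ContH1.mk f hf, ?_⟩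
  -- (4) its restriction to `Δ_Θ = c^Ẑ` is the identity: `ẑ(c^t) = t`
  change ContH1.mk (fun d => f ⟨d.1, hle d.2⟩) (ContH1.resCocycle _ _ hle ⟨f, hf⟩).2 = ContH1.mk _ _
  refine ContH1.mk_congr _ (funext fun d => ?_) _ _
  obtain ⟨t, ht⟩ := exists_cThetaχq_eq_of_mem_ker p i j d.2
  apply Subtype.ext
  show ((deltaThetaCoordχq p i j (zT d.1) : (CurveTheta.thetaToEll (curveχq p i j)).ker) :
      CurveTheta.GTheta (curveχq p i j)) = d.1
  rw [← ht, cThetaχq_apply, hzT, SemidirectProduct.left_inl, gfpFst_cGfpχ, hc, coe_deltaThetaCoordχq, cThetaχq_apply]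

/-- The same lift on `Ÿ` (restrict the `Y`-lift). [cite: MochizukiEtTh2009, Prop 1.5 (iii) p.23] -/
theorem exists_res_eq_logTheta_gtpYdd_modelχq (hj : Even j)
    (hle : (ThetaSetting.modelχq p i j hj).DeltaTheta ≤
      (ThetaSetting.modelχq p i j hj).GtpYdd.map (ThetaSetting.modelχq p i j hj).toTheta) :
    ∃ x : (ThetaSetting.modelχq p i j hj).H1Theta
        ((ThetaSetting.modelχq p i j hj).GtpYdd.map (ThetaSetting.modelχq p i j hj).toTheta),
      ContH1.res (MonoidHom.id (ThetaSetting.modelχq p i j hj).GtpTheta) (ThetaSetting.modelχq p i j hj).DeltaTheta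
        hle x = (ThetaSetting.modelχq p i j hj).logTheta := by
  obtain ⟨x, hx⟩ := exists_res_eq_logTheta_gtpY_modelχq p i j hj
    (hle.trans (ThetaSetting.modelχq p i j hj).GtpYddTheta_le)
  exact ⟨ContH1.res _ _ (ThetaSetting.modelχq p i j hj).GtpYddTheta_le x, (ContH1.res_res _ _ x).trans hx⟩

/-- **Clause (a) of Prop. 1.5 (i) HOLDS at `modelχq`** (for any Kummer core `C` of the model, which supplies the
power-limit structure of conjugation on `Δ_Θ`): restriction `H¹((Π^tp_Y)^Θ, Δ_Θ) → Hom(Δ_Θ, Δ_Θ)` is SURJECTIVE.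
[cite: MochizukiEtTh2009, Prop 1.5 (i) p.23] -/
theorem res_deltaTheta_surjective_gtpY_modelχq (hj : Even j) (C : (ThetaSetting.modelχq p i j hj).KummerCore)
    (hle : (ThetaSetting.modelχq p i j hj).DeltaTheta ≤
      (ThetaSetting.modelχq p i j hj).GtpY.map (ThetaSetting.modelχq p i j hj).toTheta) :
    Surjective (ContH1.res (MonoidHom.id (ThetaSetting.modelχq p i j hj).GtpTheta)
        (ThetaSetting.modelχq p i j hj).DeltaTheta hle :
      (ThetaSetting.modelχq p i j hj).H1Theta
          ((ThetaSetting.modelχq p i j hj).GtpY.map (ThetaSetting.modelχq p i j hj).toTheta) →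
        (ThetaSetting.modelχq p i j hj).H1Theta (ThetaSetting.modelχq p i j hj).DeltaTheta) := by
  haveI : T2Space (ThetaSetting.modelχq p i j hj).GtpTheta := CurveTheta.t2Space_GTheta (curveχq p i j)
  obtain ⟨x, hx⟩ := exists_res_eq_logTheta_gtpY_modelχq p i j hj hle
  exact C.res_deltaTheta_surjective_of_res_eq_logTheta hle x hx

/-- **Clause (a) of Prop. 1.5 (ii) HOLDS at `modelχq`**: restriction `H¹((Π^tp_Ÿ)^Θ, Δ_Θ) → Hom(Δ_Θ, Δ_Θ)` is
SURJECTIVE (any Kummer core `C`). [cite: MochizukiEtTh2009, Prop 1.5 (ii) p.23] -/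
theorem res_deltaTheta_surjective_gtpYdd_modelχq (hj : Even j) (C : (ThetaSetting.modelχq p i j hj).KummerCore)
    (hle : (ThetaSetting.modelχq p i j hj).DeltaTheta ≤
      (ThetaSetting.modelχq p i j hj).GtpYdd.map (ThetaSetting.modelχq p i j hj).toTheta) :
    Surjective (ContH1.res (MonoidHom.id (ThetaSetting.modelχq p i j hj).GtpTheta)
        (ThetaSetting.modelχq p i j hj).DeltaTheta hle :
      (ThetaSetting.modelχq p i j hj).H1Theta
          ((ThetaSetting.modelχq p i j hj).GtpYdd.map (ThetaSetting.modelχq p i j hj).toTheta) →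
        (ThetaSetting.modelχq p i j hj).H1Theta (ThetaSetting.modelχq p i j hj).DeltaTheta) := by
  haveI : T2Space (ThetaSetting.modelχq p i j hj).GtpTheta := CurveTheta.t2Space_GTheta (curveχq p i j)
  obtain ⟨x, hx⟩ := exists_res_eq_logTheta_gtpYdd_modelχq p i j hj hle
  exact C.res_deltaTheta_surjective_of_res_eq_logTheta hle x hx

/-! ### Assembly at stage 2: Prop. 1.5 (ii)/(i) for ANY section datum of `modelχq`, modulo the one datum clause -/

section Assembly

variable (hj : Even j) (C : (ThetaSetting.modelχq p i j hj).KummerCore)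
  (s : GQp p →* (ThetaSetting.modelχq p i j hj).PiTemp) (hs : Continuous s)
  (hsec : ∀ σ : GQp p, (ThetaSetting.modelχq p i j hj).aug (s σ) = σ)
  (hsY : (ThetaSetting.modelχq p i j hj).GK.map s ≤ (ThetaSetting.modelχq p i j hj).GtpY)
  (hsYdd : (ThetaSetting.modelχq p i j hj).GKdd.map s ≤ (ThetaSetting.modelχq p i j hj).GtpYdd)

include hs hsec in
/-- **[EtTh] Prop. 1.5 (ii) for ANY section Kummer datum of the stage-2 model, modulo `log(Ü) ∈ F̈¹`**: clause (a)
is the `z`-lift (this file), clause (c) is abc-iut-w5-d140's inflation–restriction through the section — so for the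
F6q/F7q data `Prop15ii` at `modelχq` is the ONE check that F6q's `log(Ü)` dies on `Δ_Θ`. [cite: MochizukiEtTh2009, Prop 1.5 (ii) p.23] -/
theorem prop15ii_ofSection_modelχq (hC : (ThetaSetting.modelχq p i j hj).Compat)
    (hUdd : C.logUdd ∈ ThetaSetting.Fdd1 hC) :
    ThetaSetting.Prop15ii (C.toKummerDataOfSection s hs hsec hsY hsYdd) hC :=
  C.prop15ii_of_section s hs hsec hsY hsYdd hC (res_deltaTheta_surjective_gtpYdd_modelχq p i j hj C _) hUdd

include hs hsec in
/-- **[EtTh] Prop. 1.5 (i) for ANY section Kummer datum of the stage-2 model, modulo `log(U) ∈ F¹`.**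
[cite: MochizukiEtTh2009, Prop 1.5 (i) p.23] -/
theorem prop15i_ofSection_modelχq (hC : (ThetaSetting.modelχq p i j hj).Compat)
    (hU : C.logU ∈ ThetaSetting.F1 hC) :
    ThetaSetting.Prop15i (C.toKummerDataOfSection s hs hsec hsY hsYdd) hC :=
  ⟨res_deltaTheta_surjective_gtpY_modelχq p i j hj C _, hU,
    C.F2_eq_range_kumY_ofSection s hs hsec hsY hsYdd⟩

end Assembly

end Literature.AnabelianGeometry.EtaleTheta.SettingModel

end
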